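import Summits.Ventures.PercRepro.C041InvStarCountL

/-!
# LEMMA (INV-STAR), the closed form of the right side (p6, gen 25; C-041.md §10 (f))

In the abstract star model, the admissible valid states with `¬G_t ∧ ρ_t` are counted exactly:

  **`card_Rset`**: `#{adm ∧ valid ∧ ¬G_t ∧ ρ_t} = Σ_A 2^{k_j(Ā)} · (2^{k_t(A)} − s_A)`

— the paper's `R = Σ_A 2^{k_{3−t}(Ā)} (2^{k_t(A)} − s_A)`.  Per `A` (`card_Rfiber`): a state is in the fibre iff every
`t`-edge at a closed leaf is red, every open leaf `i` satisfies the LEAF CONDITION `C` (admissible: not a blue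
`t`-edge together with a blue `j`-edge; `¬G_t`: all `t`-edges red ⟹ all `j`-edges blue) and some open leaf carries a
red edge (`mem_Rfiber_iff`); the leaf colourings are a product over the leaves (`Fintype.piFinset`): a closed leaf
contributes `2^{k_j}` (`card_Rleaf`), an open leaf `2^{k_t}` (`card_Cleaf`: the `j`-edges are determined by the
`t`-edges), and the states with no red edge at any open leaf contribute `s_i` per open leaf (`card_CNRleaf`); the
fibre is the difference (`Rfiber_eq_image`, `card_Pf`, `card_Pf'`).  With `card_Lset` this completes the two closed
forms of §10 (f); the termwise inequality and the re-derivation of (INV-STAR) from the closed forms are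
`C041InvStarCountIneq`.
-/

namespace PercRepro

namespace InvStar

open Finset

section Leaf

variable (k m : ℕ)

/-- The leaf condition of an open leaf: admissible and `¬G_t`-compatible. -/
def LeafC (p : (Fin k → Bool) × (Fin m → Bool)) : Prop :=
  ¬ ((∃ e, p.1 e = false) ∧ (∃ e, p.2 e = false)) ∧ ((∀ e, p.1 e = true) → ∀ e, p.2 e = false)

/-- No red edge at the leaf. -/
def LeafNR (p : (Fin k → Bool) × (Fin m → Bool)) : Prop := (∀ e, p.1 e = false) ∧ (∀ e, p.2 e = false)

open Classical in
/-- The colourings of a closed leaf: all `t`-edges red, the `j`-edges free. -/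
noncomputable def Rleaf : Finset ((Fin k → Bool) × (Fin m → Bool)) := univ.filter fun p => ∀ e, p.1 e = true

open Classical in
/-- The colourings of an open leaf satisfying the leaf condition. -/
noncomputable def Cleaf : Finset ((Fin k → Bool) × (Fin m → Bool)) := univ.filter fun p => LeafC k m p

open Classical in
/-- The colourings of an open leaf satisfying the leaf condition with no red edge. -/
noncomputable def CNRleaf : Finset ((Fin k → Bool) × (Fin m → Bool)) :=
  univ.filter fun p => LeafC k m p ∧ LeafNR k m p

open Classical in
/-- `#Rleaf = 2^m`. -/
theorem card_Rleaf : (Rleaf k m).card = 2 ^ m := by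
  have h : Rleaf k m = ({fun _ => true} : Finset (Fin k → Bool)) ×ˢ (univ : Finset (Fin m → Bool)) := by
    ext p
    unfold Rleaf
    rw [Finset.mem_filter, Finset.mem_product, Finset.mem_singleton]
    simp only [Finset.mem_univ, true_and, and_true]
    constructor
    · intro h
      funext e
      exact h e
    · intro h e
      rw [h]
  rw [h, Finset.card_product, Finset.card_singleton, one_mul, card_fun_bool]

/-- The `j`-colouring determined by a `t`-colouring under the leaf condition: blue iff all `t`-edges are red. -/
def foOf (ft : Fin k → Bool) : Fin m → Bool := fun _ => decide (¬ ∀ e, ft e = true)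

open Classical in
/-- `Cleaf` is the graph of `foOf` over all `t`-colourings. -/
theorem Cleaf_eq_image : Cleaf k m = (univ : Finset (Fin k → Bool)).image fun ft => (ft, foOf k m ft) := by
  ext p
  unfold Cleaf
  rw [Finset.mem_filter, Finset.mem_image]
  simp only [Finset.mem_univ, true_and]
  unfold LeafC
  constructor
  · rintro ⟨h1, h2⟩
    refine ⟨p.1, ?_⟩
    obtain ⟨ft, fo⟩ := p
    simp only at h1 h2 ⊢
    congr
    funext e
    unfold foOf
    by_cases hall : ∀ e, ft e = true
    · rw [h2 hall e]
      simp [hall]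
    · have hblue : ∃ e, ft e = false := by
        by_contra h
        apply hall
        intro e
        cases he : ft e
        · exact absurd ⟨e, he⟩ h
        · rfl
      have : ¬ ∃ e, fo e = false := fun h => h1 ⟨hblue, h⟩
      have hred : fo e = true := by
        cases he : fo e
        · exact absurd ⟨e, he⟩ this
        · rfl
      rw [hred]
      simp [hall]
  · rintro ⟨ft, rfl⟩
    unfold foOf
    simp only
    by_cases hall : ∀ e, ft e = true
    · refine ⟨fun h => ?_, fun _ _ => by simp [hall]⟩
      obtain ⟨⟨e, he⟩, _⟩ := h
      rw [hall e] at he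
      exact Bool.noConfusion he
    · refine ⟨fun h => ?_, fun h => absurd h hall⟩
      obtain ⟨_, ⟨e, he⟩⟩ := h
      simp [hall] at he

open Classical in
/-- `#Cleaf = 2^k`. -/
theorem card_Cleaf : (Cleaf k m).card = 2 ^ k := by
  rw [Cleaf_eq_image, Finset.card_image_of_injective, card_fun_bool]
  intro ft ft' h
  exact congrArg Prod.fst h

open Classical in
/-- `#CNRleaf = [k = 0 ∨ m = 0]`. -/
theorem card_CNRleaf : (CNRleaf k m).card = if k = 0 ∨ m = 0 then 1 else 0 := by
  by_cases hs : k = 0 ∨ m = 0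
  · rw [if_pos hs]
    have h : CNRleaf k m = {(fun _ => false, fun _ => false)} := by
      ext p
      unfold CNRleaf
      rw [Finset.mem_filter, Finset.mem_singleton]
      simp only [Finset.mem_univ, true_and]
      unfold LeafC LeafNR
      constructor
      · rintro ⟨_, h1, h2⟩
        obtain ⟨ft, fo⟩ := p
        simp only at h1 h2
        congr
        · funext e
          exact h1 e
        · funext e
          exact h2 e
      · rintro rfl
        refine ⟨⟨fun h => ?_, fun _ _ => rfl⟩, fun _ => rfl, fun _ => rfl⟩
        obtain ⟨⟨e, _⟩, ⟨f, _⟩⟩ := h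
        rcases hs with h0 | h0
        · exact absurd e.2 (by omega)
        · exact absurd f.2 (by omega)
    rw [h, Finset.card_singleton]
  · rw [if_neg hs]
    rw [not_or] at hs
    rw [Finset.card_eq_zero, Finset.eq_empty_iff_forall_notMem]
    intro p hp
    unfold CNRleaf at hp
    rw [Finset.mem_filter] at hp
    unfold LeafC LeafNR at hp
    obtain ⟨_, ⟨h1, _⟩, h2, h3⟩ := hp
    exact h1 ⟨⟨⟨0, Nat.pos_of_ne_zero hs.1⟩, h2 _⟩, ⟨⟨0, Nat.pos_of_ne_zero hs.2⟩, h3 _⟩⟩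

open Classical in
/-- `CNRleaf ⊆ Cleaf`. -/
theorem CNRleaf_subset : CNRleaf k m ⊆ Cleaf k m := by
  intro p hp
  unfold CNRleaf at hp
  unfold Cleaf
  rw [Finset.mem_filter] at hp ⊢
  exact ⟨hp.1, hp.2.1⟩

end Leaf

variable {ι : Type*} [Fintype ι] [DecidableEq ι] (kt ko : ι → ℕ)

/-- `k_j(Ā) = Σ_{i ∉ A} k_j(i)`. -/
def koBar (A : Finset ι) : ℕ := ∑ i ∈ Aᶜ, ko i

/-- `k_t(A) = Σ_{i ∈ A} k_t(i)`. -/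
def ktIn (A : Finset ι) : ℕ := ∑ i ∈ A, kt i

open Classical in
/-- The right side of (INV): the admissible valid states with `¬G_t ∧ ρ_t`. -/
noncomputable def Rset : Finset (StarState ι kt ko) :=
  univ.filter fun s => AdmS s ∧ ¬ InvalidS s ∧ ¬ GoodS s ∧ RhoS s

open Classical in
/-- The fibre of the right side over the open set `A`. -/
noncomputable def Rfiber (A : Finset ι) : Finset (StarState ι kt ko) :=
  (Rset kt ko).filter fun s => s.1 = A

/-- The leaf colourings of a state, leaf by leaf. -/
def toPi (s : StarState ι kt ko) : (i : ι) → (Fin (kt i) → Bool) × (Fin (ko i) → Bool) :=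
  fun i => (s.2.1 i, s.2.2 i)

omit [Fintype ι] [DecidableEq ι] in
/-- **The fibre, characterised**: every `t`-edge at a closed leaf red, the leaf condition at every open leaf, and a
red edge at some open leaf. -/
theorem mem_Rfiber_iff' (A : Finset ι) (s : StarState ι kt ko) :
    (AdmS s ∧ ¬ InvalidS s ∧ ¬ GoodS s ∧ RhoS s) ∧ s.1 = A ↔
      s.1 = A ∧ (∀ i, i ∉ A → ∀ e, s.2.1 i e = true) ∧ (∀ i ∈ A, LeafC (kt i) (ko i) (toPi kt ko s i)) ∧
        ¬ ∀ i ∈ A, LeafNR (kt i) (ko i) (toPi kt ko s i) := by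
  constructor
  · rintro ⟨⟨hadm, hinv, hgood, hρ⟩, hA⟩
    subst hA
    refine ⟨rfl, hρ, fun i hi => ⟨hadm.1 i hi, fun hall e => ?_⟩, fun h => hinv fun i hi => h i hi⟩
    by_contra he
    have he' : s.2.2 i e = true := by
      cases h : s.2.2 i e
      · exact absurd h he
      · rfl
    exact hgood ⟨hρ, i, hi, hall, e, he'⟩
  · rintro ⟨hA, hρ, hC, hNR⟩
    subst hA
    refine ⟨⟨⟨fun i hi => (hC i hi).1, fun h => ?_⟩, fun hinv => hNR fun i hi => hinv i hi, fun hg => ?_, hρ⟩, rfl⟩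
    · obtain ⟨⟨i, hi, e, he⟩, _⟩ := h
      rw [hρ i hi e] at he
      exact Bool.noConfusion he
    · obtain ⟨_, i, hi, hall, e, he⟩ := hg
      have h' : s.2.2 i e = false := (hC i hi).2 hall e
      rw [h'] at he
      exact Bool.noConfusion he

open Classical in
/-- Membership in the fibre. -/
theorem mem_Rfiber_iff (A : Finset ι) (s : StarState ι kt ko) :
    s ∈ Rfiber kt ko A ↔
      s.1 = A ∧ (∀ i, i ∉ A → ∀ e, s.2.1 i e = true) ∧ (∀ i ∈ A, LeafC (kt i) (ko i) (toPi kt ko s i)) ∧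
        ¬ ∀ i ∈ A, LeafNR (kt i) (ko i) (toPi kt ko s i) := by
  unfold Rfiber Rset
  rw [Finset.mem_filter, Finset.mem_filter]
  simp only [Finset.mem_univ, true_and]
  exact mem_Rfiber_iff' kt ko A s

open Classical in
/-- The product of the leaf sets: closed leaves `Rleaf`, open leaves `Cleaf`. -/
noncomputable def Pf (A : Finset ι) : Finset ((i : ι) → (Fin (kt i) → Bool) × (Fin (ko i) → Bool)) :=
  Fintype.piFinset fun i => if i ∈ A then Cleaf (kt i) (ko i) else Rleaf (kt i) (ko i)

open Classical in
/-- The product of the leaf sets with no red edge at the open leaves. -/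
noncomputable def Pf' (A : Finset ι) : Finset ((i : ι) → (Fin (kt i) → Bool) × (Fin (ko i) → Bool)) :=
  Fintype.piFinset fun i => if i ∈ A then CNRleaf (kt i) (ko i) else Rleaf (kt i) (ko i)

open Classical in
/-- Membership in `Pf`. -/
theorem mem_Pf (A : Finset ι) (f : (i : ι) → (Fin (kt i) → Bool) × (Fin (ko i) → Bool)) :
    f ∈ Pf kt ko A ↔ (∀ i, i ∉ A → ∀ e, (f i).1 e = true) ∧ ∀ i ∈ A, LeafC (kt i) (ko i) (f i) := by
  unfold Pf
  rw [Fintype.mem_piFinset]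
  constructor
  · intro h
    refine ⟨fun i hi => ?_, fun i hi => ?_⟩
    · have := h i
      rw [if_neg hi] at this
      unfold Rleaf at this
      rw [Finset.mem_filter] at this
      exact this.2
    · have := h i
      rw [if_pos hi] at this
      unfold Cleaf at this
      rw [Finset.mem_filter] at this
      exact this.2
  · rintro ⟨h1, h2⟩ i
    by_cases hi : i ∈ A
    · rw [if_pos hi]
      unfold Cleaf
      rw [Finset.mem_filter]
      exact ⟨Finset.mem_univ _, h2 i hi⟩
    · rw [if_neg hi]
      unfold Rleaf
      rw [Finset.mem_filter]
      exact ⟨Finset.mem_univ _, h1 i hi⟩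

open Classical in
/-- Membership in `Pf'`. -/
theorem mem_Pf' (A : Finset ι) (f : (i : ι) → (Fin (kt i) → Bool) × (Fin (ko i) → Bool)) :
    f ∈ Pf' kt ko A ↔ (∀ i, i ∉ A → ∀ e, (f i).1 e = true) ∧
      ∀ i ∈ A, LeafC (kt i) (ko i) (f i) ∧ LeafNR (kt i) (ko i) (f i) := by
  unfold Pf'
  rw [Fintype.mem_piFinset]
  constructor
  · intro h
    refine ⟨fun i hi => ?_, fun i hi => ?_⟩
    · have := h i
      rw [if_neg hi] at this
      unfold Rleaf at this
      rw [Finset.mem_filter] at this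
      exact this.2
    · have := h i
      rw [if_pos hi] at this
      unfold CNRleaf at this
      rw [Finset.mem_filter] at this
      exact this.2
  · rintro ⟨h1, h2⟩ i
    by_cases hi : i ∈ A
    · rw [if_pos hi]
      unfold CNRleaf
      rw [Finset.mem_filter]
      exact ⟨Finset.mem_univ _, h2 i hi⟩
    · rw [if_neg hi]
      unfold Rleaf
      rw [Finset.mem_filter]
      exact ⟨Finset.mem_univ _, h1 i hi⟩

open Classical in
/-- `Pf' ⊆ Pf`. -/
theorem Pf'_subset (A : Finset ι) : Pf' kt ko A ⊆ Pf kt ko A := by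
  intro f hf
  rw [mem_Pf'] at hf
  rw [mem_Pf]
  exact ⟨hf.1, fun i hi => (hf.2 i hi).1⟩

/-- A product over `if i ∈ A then a i else b i` splits as `(∏_{A} a)·(∏_{Aᶜ} b)`. -/
theorem prod_ite_mem_compl (A : Finset ι) (a b : ι → ℕ) :
    ∏ i, (if i ∈ A then a i else b i) = (∏ i ∈ A, a i) * ∏ i ∈ Aᶜ, b i := by
  rw [Finset.prod_ite, Finset.filter_mem_eq_inter, Finset.univ_inter, Finset.filter_not,
    Finset.filter_mem_eq_inter, Finset.univ_inter, Finset.compl_eq_univ_sdiff]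

open Classical in
/-- `#Pf = 2^{k_t(A)} · 2^{k_j(Ā)}`. -/
theorem card_Pf (A : Finset ι) : (Pf kt ko A).card = 2 ^ ktIn kt A * 2 ^ koBar ko A := by
  unfold Pf ktIn koBar
  rw [Fintype.card_piFinset]
  have h : ∀ i, (if i ∈ A then Cleaf (kt i) (ko i) else Rleaf (kt i) (ko i)).card
      = if i ∈ A then 2 ^ kt i else 2 ^ ko i := by
    intro i
    by_cases hi : i ∈ A
    · rw [if_pos hi, if_pos hi, card_Cleaf]
    · rw [if_neg hi, if_neg hi, card_Rleaf]
  rw [Finset.prod_congr rfl fun i _ => h i, prod_ite_mem_compl, Finset.prod_pow_eq_pow_sum,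
    Finset.prod_pow_eq_pow_sum]

open Classical in
/-- `#Pf' = s_A · 2^{k_j(Ā)}`. -/
theorem card_Pf' (A : Finset ι) : (Pf' kt ko A).card = sProd kt ko A * 2 ^ koBar ko A := by
  unfold Pf' koBar sProd sBit
  rw [Fintype.card_piFinset]
  have h : ∀ i, (if i ∈ A then CNRleaf (kt i) (ko i) else Rleaf (kt i) (ko i)).card
      = if i ∈ A then (if kt i = 0 ∨ ko i = 0 then 1 else 0) else 2 ^ ko i := by
    intro i
    by_cases hi : i ∈ A
    · rw [if_pos hi, if_pos hi, card_CNRleaf]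
    · rw [if_neg hi, if_neg hi, card_Rleaf]
  rw [Finset.prod_congr rfl fun i _ => h i, prod_ite_mem_compl, Finset.prod_pow_eq_pow_sum]

open Classical in
/-- The fibre is the image of `Pf \ Pf'` under the assembly of a state. -/
theorem Rfiber_eq_image (A : Finset ι) :
    Rfiber kt ko A = (Pf kt ko A \ Pf' kt ko A).image
      (fun f => ((A, fun i => (f i).1, fun i => (f i).2) : StarState ι kt ko)) := by
  ext s
  rw [mem_Rfiber_iff, Finset.mem_image]
  constructor
  · rintro ⟨hA, hρ, hC, hNR⟩
    refine ⟨toPi kt ko s, ?_, ?_⟩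
    · rw [Finset.mem_sdiff, mem_Pf, mem_Pf']
      refine ⟨⟨hρ, hC⟩, fun h => hNR fun i hi => (h.2 i hi).2⟩
    · obtain ⟨A', t, o⟩ := s
      simp only at hA
      subst hA
      rfl
  · rintro ⟨f, hf, rfl⟩
    rw [Finset.mem_sdiff, mem_Pf, mem_Pf'] at hf
    obtain ⟨⟨h1, h2⟩, h3⟩ := hf
    refine ⟨rfl, h1, h2, fun h => h3 ⟨h1, fun i hi => ⟨h2 i hi, h i hi⟩⟩⟩

open Classical in
/-- **The fibre count**: `#Rfiber(A) = 2^{k_j(Ā)} · (2^{k_t(A)} − s_A)`. -/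
theorem card_Rfiber (A : Finset ι) :
    (Rfiber kt ko A).card = 2 ^ koBar ko A * (2 ^ ktIn kt A - sProd kt ko A) := by
  rw [Rfiber_eq_image, Finset.card_image_of_injective, Finset.card_sdiff_of_subset (Pf'_subset kt ko A),
    card_Pf, card_Pf', Nat.mul_sub, mul_comm (sProd kt ko A), mul_comm (2 ^ ktIn kt A)]
  intro f f' h
  funext i
  have h1 := congrFun (congrArg (fun s : StarState ι kt ko => s.2.1) h) i
  have h2 := congrFun (congrArg (fun s : StarState ι kt ko => s.2.2) h) i
  exact Prod.ext h1 h2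

open Classical in
/-- **THE CLOSED FORM OF THE RIGHT SIDE** (C-041.md §10 (f)):
`#{adm ∧ valid ∧ ¬G_t ∧ ρ_t} = Σ_A 2^{k_j(Ā)} (2^{k_t(A)} − s_A)`. -/
theorem card_Rset : (Rset kt ko).card = ∑ A : Finset ι, 2 ^ koBar ko A * (2 ^ ktIn kt A - sProd kt ko A) := by
  rw [Finset.card_eq_sum_card_fiberwise (f := fun s : StarState ι kt ko => s.1) (t := univ)
    (fun _ _ => Finset.mem_univ _)]
  apply Finset.sum_congr rfl
  intro A _
  exact card_Rfiber kt ko A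

end InvStar

end PercRepro
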